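import Summits.ResolutionOfSingularities.ResolutionOfSingularities.Theorems.MarkedTransferCampaignW22SevenCurves
import Literature.NumberTheory.QuadraticFields.ChowlaCentralFactorialProofs
import HarnessLib

/-!
# [OURS · L1 W2.2] THE GRID SUBSTITUTION `X₀ ↦ T, X₁ ↦ aT², X₂ ↦ bT²` (coefficient formula) and the POWER-SUM contradiction over
# the prime field — plumbing for the all-`p` refutation of «uniform A1» in ambient dimension 3
# (RESCUE-SEED slot W2.2, group L-G2; cell `res-hironaka`, rung L of LADDER-RESOLUTION)

Cell `res-hironaka`, host item `MarkedTransfer.MarkedOrderReductionP` (stmt-15520) as `--supports` helper. Proof file (theorems only),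
written by res-type-055 gen 8 (reserve volunteer); consumed by `MarkedTransferCampaignW22UniformContactDimThreeNegativeAllP.lean`.

HONEST FRAMING. Everything here is OURS plumbing (a campaign computation); NOTHING here is a statement of H. Hironaka's manuscript
*Resolution of singularities in positive characteristics* (2017-03-23, [Hironaka2017], lit key `paper:url-3343fd9e678b`) or of any
cited paper. AI mathematics; weaker than expert review.

CONTENTS (any field `K`; `p` prime where stated):
* `prod_pow_grid`, `coeff_subst_grid` — for `f ∈ K⟦X₀,X₁,X₂⟧` and every `N`:
  `[T^N] f(T, aT², bT²) = Σ_{2j+2l ≤ N} a^j b^l · [X₀^{N−2j−2l} X₁^j X₂^l] f` (a finite sum; from Mathlib's `MvPowerSeries.coeff_subst`);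
* `subst_grid_eq_zero_of_mem` — the substitution kills the ideal `(X₁ − aX₀², X₂ − bX₀²)` of its parabola;
* power sums `Σ_{x ∈ 𝔽_p} x^k = 0` (`k < p − 1`), `= −1` (`k = p − 1`) are REUSED from the tree
  (`Literature.NumberTheory.QuadraticFields.ChowlaProof.sum_pow_eq_zero_of_lt` / `sum_pow_card_sub_one`);
* `grid_powerSum_contradiction` — no constants `c_{jl}` (`2j + 2l ≤ 2p`, `c_{jl} = 0` when `j + l ≥ p`) make
  `a b^{p−1} + Σ c_{jl} a^j b^l` vanish for all `a, b` in the prime field of a field of characteristic `p`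
  (weight by `a^{p−2}`, sum over `𝔽_p × 𝔽_p`: `1 = 0`).

## References
* H. Hironaka, *Resolution of singularities in positive characteristics*, manuscript 2017-03-23 (lit key `paper:url-3343fd9e678b`) —
  ROLE only (the objects are those of the W2.2 uniform-A1 rows, p499805). [Hironaka2017] [claim: Hironaka2017, status: under-review]
* Cell files: tree `…W22SevenCurves.lean` (p500714, res-type-068: substitution pattern), `…W22GridWitness.lean` (p512362).
-/

set_option linter.dupNamespace false -- mandated namespace of this single-conjunct summit

noncomputable section

namespace Summit.ResolutionOfSingularities.ResolutionOfSingularities.Theorems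

namespace CampaignW22

open MvPowerSeries (X C)

/-! ## 1. The substitution `X₀ ↦ T, X₁ ↦ aT², X₂ ↦ bT²` and its coefficients -/

section Subst

variable (K : Type) [Field K]

/-- [OURS · L1 W2.2] plumbing for the witness (no manuscript content): the monomial `X^d` goes to `a^{d₁}b^{d₂}·T^{d₀+2d₁+2d₂}` under
`X₀ ↦ T, X₁ ↦ aT², X₂ ↦ bT²`. [folklore] -/
theorem prod_pow_grid (a b : K) (d : Fin 3 →₀ ℕ) :
    d.prod (fun s n => (![PowerSeries.X, PowerSeries.C a * PowerSeries.X ^ 2, PowerSeries.C b * PowerSeries.X ^ 2] :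
        Fin 3 → PowerSeries K) s ^ n) =
      PowerSeries.C (a ^ d 1 * b ^ d 2) * PowerSeries.X ^ (d 0 + 2 * d 1 + 2 * d 2) := by
  rw [Finsupp.prod_fintype _ _ (fun i => pow_zero _), Fin.prod_univ_three]
  simp only [Matrix.cons_val_zero, Matrix.cons_val_one, Matrix.cons_val_two, Matrix.tail_cons, Matrix.head_cons]
  rw [mul_pow, mul_pow, ← map_pow, ← map_pow, ← pow_mul, ← pow_mul, map_mul, pow_add, pow_add]
  ring

/-- [OURS · L1 W2.2] plumbing for the witness (no manuscript content): THE COEFFICIENT FORMULA of the grid substitution — for every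
`f ∈ K⟦X₀,X₁,X₂⟧` and `N`, `[T^N] f(T, aT², bT²) = Σ_{2j+2l ≤ N} a^j b^l · [X₀^{N−2j−2l} X₁^j X₂^l] f` (a FINITE sum; any field).
[folklore] -/
theorem coeff_subst_grid (a b : K) (f : MvPowerSeries (Fin 3) K) (N : ℕ) :
    PowerSeries.coeff N (MvPowerSeries.subst
        (![PowerSeries.X, PowerSeries.C a * PowerSeries.X ^ 2, PowerSeries.C b * PowerSeries.X ^ 2] : Fin 3 → PowerSeries K) f) =
      ∑ jl ∈ ((Finset.range (N + 1)) ×ˢ (Finset.range (N + 1))).filter (fun jl : ℕ × ℕ => 2 * jl.1 + 2 * jl.2 ≤ N),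
        a ^ jl.1 * b ^ jl.2 *
          MvPowerSeries.coeff (Finsupp.single 0 (N - 2 * jl.1 - 2 * jl.2) + Finsupp.single 1 jl.1 + Finsupp.single 2 jl.2) f := by
  classical
  set γ : Fin 3 → PowerSeries K :=
    ![PowerSeries.X, PowerSeries.C a * PowerSeries.X ^ 2, PowerSeries.C b * PowerSeries.X ^ 2] with hγ
  have hγ0 : ∀ s, PowerSeries.constantCoeff (γ s) = 0 := by
    intro s; fin_cases s <;> simp [hγ]
  have hγs : MvPowerSeries.HasSubst γ := MvPowerSeries.hasSubst_of_constantCoeff_zero hγ0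
  set I : Finset (ℕ × ℕ) := ((Finset.range (N + 1)) ×ˢ (Finset.range (N + 1))).filter
    (fun jl : ℕ × ℕ => 2 * jl.1 + 2 * jl.2 ≤ N) with hI
  set e : ℕ × ℕ → (Fin 3 →₀ ℕ) := fun jl =>
    Finsupp.single 0 (N - 2 * jl.1 - 2 * jl.2) + Finsupp.single 1 jl.1 + Finsupp.single 2 jl.2 with he
  have he0 : ∀ jl, e jl 0 = N - 2 * jl.1 - 2 * jl.2 := fun jl => by simp [he]
  have he1 : ∀ jl, e jl 1 = jl.1 := fun jl => by simp [he]
  have he2 : ∀ jl, e jl 2 = jl.2 := fun jl => by simp [he]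
  have hmemI : ∀ jl, jl ∈ I ↔ 2 * jl.1 + 2 * jl.2 ≤ N := by
    intro jl
    simp only [hI, Finset.mem_filter, Finset.mem_product, Finset.mem_range]
    constructor
    · exact fun h => h.2
    · intro h; exact ⟨⟨by omega, by omega⟩, h⟩
  have hcoef : ∀ d : Fin 3 →₀ ℕ, MvPowerSeries.coeff (Finsupp.single () N) (d.prod fun s n => γ s ^ n) =
      if d 0 + 2 * d 1 + 2 * d 2 = N then a ^ d 1 * b ^ d 2 else 0 := by
    intro d
    rw [prod_pow_grid K a b d]
    change PowerSeries.coeff N _ = _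
    rw [PowerSeries.coeff_C_mul_X_pow]
    by_cases h : d 0 + 2 * d 1 + 2 * d 2 = N
    · rw [if_pos h, if_pos h.symm]
    · rw [if_neg h, if_neg (Ne.symm h)]
  rw [PowerSeries.coeff, MvPowerSeries.coeff_subst hγs]
  simp only [hcoef]
  have hsupp : (Function.support fun d : Fin 3 →₀ ℕ =>
      MvPowerSeries.coeff d f • (if d 0 + 2 * d 1 + 2 * d 2 = N then a ^ d 1 * b ^ d 2 else 0)) ⊆
      ↑(I.image e) := by
    intro d hd
    rw [Function.mem_support] at hd
    have hw : d 0 + 2 * d 1 + 2 * d 2 = N := by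
      by_contra h
      exact hd (by rw [if_neg h, smul_zero])
    rw [Finset.coe_image]
    refine ⟨(d 1, d 2), ?_, ?_⟩
    · rw [Finset.mem_coe, hmemI]; omega
    · ext i
      fin_cases i
      · show e (d 1, d 2) 0 = d 0
        rw [he0]; omega
      · exact he1 _
      · exact he2 _
  rw [finsum_eq_sum_of_support_subset _ hsupp, Finset.sum_image]
  · refine Finset.sum_congr rfl fun jl hjl => ?_
    have hw : e jl 0 + 2 * e jl 1 + 2 * e jl 2 = N := by
      rw [he0, he1, he2]; have := (hmemI jl).mp hjl; omega
    rw [if_pos hw, he1, he2, smul_eq_mul]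
    ring
  · intro jl _ jl' _ h
    have h1 := congrArg (fun d => d 1) h
    have h2 := congrArg (fun d => d 2) h
    simp only [he1, he2] at h1 h2
    exact Prod.ext h1 h2

/-- [OURS · L1 W2.2] plumbing for the witness (no manuscript content): the grid substitution KILLS the ideal of its parabola —
every `f ∈ (X₁ − aX₀², X₂ − bX₀²)` has `f(T, aT², bT²) = 0`. [folklore] -/
theorem subst_grid_eq_zero_of_mem (a b : K) {f : MvPowerSeries (Fin 3) K}
    (hf : f ∈ Ideal.span ({X 1 - C a * X 0 ^ 2, X 2 - C b * X 0 ^ 2} : Set (MvPowerSeries (Fin 3) K))) :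
    MvPowerSeries.subst
        (![PowerSeries.X, PowerSeries.C a * PowerSeries.X ^ 2, PowerSeries.C b * PowerSeries.X ^ 2] : Fin 3 → PowerSeries K)
        f = 0 := by
  set γ : Fin 3 → PowerSeries K :=
    ![PowerSeries.X, PowerSeries.C a * PowerSeries.X ^ 2, PowerSeries.C b * PowerSeries.X ^ 2] with hγ
  have hγ0 : ∀ s, PowerSeries.constantCoeff (γ s) = 0 := by
    intro s; fin_cases s <;> simp [hγ]
  have hγs : MvPowerSeries.HasSubst γ := MvPowerSeries.hasSubst_of_constantCoeff_zero hγ0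
  set φ := MvPowerSeries.substAlgHom (R := K) hγs with hφ
  have hφX : ∀ s, φ (X s) = γ s := fun s => MvPowerSeries.substAlgHom_X hγs s
  have hφC : ∀ r : K, φ (C r) = PowerSeries.C r := by
    intro r
    have h := φ.commutes r
    rwa [MvPowerSeries.algebraMap_apply, Algebra.algebraMap_self, RingHom.id_apply,
      PowerSeries.algebraMap_eq] at h
  have hle : Ideal.span ({X 1 - C a * X 0 ^ 2, X 2 - C b * X 0 ^ 2} : Set (MvPowerSeries (Fin 3) K)) ≤
      RingHom.ker (φ : MvPowerSeries (Fin 3) K →+* PowerSeries K) := by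
    rw [Ideal.span_le]
    intro f hf
    simp only [Set.mem_insert_iff, Set.mem_singleton_iff] at hf
    rw [SetLike.mem_coe, RingHom.mem_ker, AlgHom.coe_toRingHom]
    have h0 : γ 0 = PowerSeries.X := rfl
    have h1 : γ 1 = PowerSeries.C a * PowerSeries.X ^ 2 := rfl
    have h2 : γ 2 = PowerSeries.C b * PowerSeries.X ^ 2 := rfl
    rcases hf with rfl | rfl
    · rw [map_sub, map_mul, map_pow, hφX, hφX, hφC, h0, h1, sub_self]
    · rw [map_sub, map_mul, map_pow, hφX, hφX, hφC, h0, h2, sub_self]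
  have h := hle hf
  rwa [RingHom.mem_ker, AlgHom.coe_toRingHom, hφ, MvPowerSeries.substAlgHom_apply] at h

end Subst

/-! ## 2. Power sums over the prime field -/

section PowerSums

variable (p : ℕ) [Fact p.Prime]

/-- [OURS · L1 W2.2] THE ARITHMETIC CORE OF THE GRID OBSTRUCTION (no manuscript content): in a field `K` of characteristic `p`, no
family of constants `c_{jl}` (indexed by `2j + 2l ≤ 2p`, vanishing when `j + l ≥ p`) satisfies
`a b^{p−1} + Σ c_{jl} a^j b^l = 0` for ALL `a, b` in the prime field: weighting by `a^{p−2}` and summing over `𝔽_p × 𝔽_p` gives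
`1 = 0` by the power sums. [folklore] -/
theorem grid_powerSum_contradiction (K : Type) [Field K] [CharP K p] (c : ℕ × ℕ → K)
    (hc : ∀ jl : ℕ × ℕ, 2 * jl.1 + 2 * jl.2 ≤ 2 * p → p ≤ jl.1 + jl.2 → c jl = 0)
    (hE : ∀ a b : ZMod p,
      (ZMod.castHom (dvd_refl p) K a) * (ZMod.castHom (dvd_refl p) K b) ^ (p - 1) +
        ∑ jl ∈ ((Finset.range (2 * p + 1)) ×ˢ (Finset.range (2 * p + 1))).filter
            (fun jl : ℕ × ℕ => 2 * jl.1 + 2 * jl.2 ≤ 2 * p),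
          c jl * (ZMod.castHom (dvd_refl p) K a) ^ jl.1 * (ZMod.castHom (dvd_refl p) K b) ^ jl.2 = 0) :
    False := by
  classical
  have hp2 := (Fact.out : p.Prime).two_le
  set ι : ZMod p →+* K := ZMod.castHom (dvd_refl p) K with hι
  set I : Finset (ℕ × ℕ) := ((Finset.range (2 * p + 1)) ×ˢ (Finset.range (2 * p + 1))).filter
    (fun jl : ℕ × ℕ => 2 * jl.1 + 2 * jl.2 ≤ 2 * p) with hI
  -- power sums transported to `K`
  have hS : ∀ k : ℕ, ∑ x : ZMod p, ι x ^ k = ι (∑ x : ZMod p, x ^ k) := by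
    intro k; rw [map_sum]; simp_rw [map_pow]
  have hS0 : ∀ k : ℕ, k < p - 1 → ∑ x : ZMod p, ι x ^ k = 0 := by
    intro k hk; rw [hS, Literature.NumberTheory.QuadraticFields.ChowlaProof.sum_pow_eq_zero_of_lt (p := p) hk, map_zero]
  have hS1 : ∑ x : ZMod p, ι x ^ (p - 1) = -1 := by
    rw [hS, Literature.NumberTheory.QuadraticFields.ChowlaProof.sum_pow_card_sub_one (p := p), map_neg, map_one]
  -- sum `a^{p-2} · E(a,b)` over the grid
  have hsum : ∑ a : ZMod p, ∑ b : ZMod p, ι a ^ (p - 2) *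
      (ι a * ι b ^ (p - 1) + ∑ jl ∈ I, c jl * ι a ^ jl.1 * ι b ^ jl.2) = 0 := by
    refine Finset.sum_eq_zero fun a _ => Finset.sum_eq_zero fun b _ => ?_
    rw [hE a b, mul_zero]
  -- evaluate the same double sum
  have hpa : ∀ a : ZMod p, ι a ^ (p - 2) * ι a = ι a ^ (p - 1) := by
    intro a; rw [← pow_succ]; congr 1; omega
  have hA : ∑ a : ZMod p, ∑ b : ZMod p, ι a ^ (p - 2) * (ι a * ι b ^ (p - 1)) =
      (∑ a : ZMod p, ι a ^ (p - 1)) * (∑ b : ZMod p, ι b ^ (p - 1)) := by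
    rw [Finset.sum_mul]
    refine Finset.sum_congr rfl fun a _ => ?_
    rw [Finset.mul_sum]
    refine Finset.sum_congr rfl fun b _ => ?_
    rw [← mul_assoc, hpa]
  have hB : ∑ a : ZMod p, ∑ b : ZMod p, ι a ^ (p - 2) * (∑ jl ∈ I, c jl * ι a ^ jl.1 * ι b ^ jl.2) =
      ∑ jl ∈ I, c jl * ((∑ a : ZMod p, ι a ^ (p - 2 + jl.1)) * (∑ b : ZMod p, ι b ^ jl.2)) := by
    calc ∑ a : ZMod p, ∑ b : ZMod p, ι a ^ (p - 2) * (∑ jl ∈ I, c jl * ι a ^ jl.1 * ι b ^ jl.2)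
        = ∑ a : ZMod p, ∑ b : ZMod p, ∑ jl ∈ I, ι a ^ (p - 2) * (c jl * ι a ^ jl.1 * ι b ^ jl.2) := by
          refine Finset.sum_congr rfl fun a _ => Finset.sum_congr rfl fun b _ => ?_
          rw [Finset.mul_sum]
      _ = ∑ a : ZMod p, ∑ jl ∈ I, ∑ b : ZMod p, ι a ^ (p - 2) * (c jl * ι a ^ jl.1 * ι b ^ jl.2) :=
          Finset.sum_congr rfl fun a _ => Finset.sum_comm
      _ = ∑ jl ∈ I, ∑ a : ZMod p, ∑ b : ZMod p, ι a ^ (p - 2) * (c jl * ι a ^ jl.1 * ι b ^ jl.2) := Finset.sum_comm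
      _ = ∑ jl ∈ I, c jl * ((∑ a : ZMod p, ι a ^ (p - 2 + jl.1)) * (∑ b : ZMod p, ι b ^ jl.2)) := by
          refine Finset.sum_congr rfl fun jl _ => ?_
          rw [Finset.sum_mul_sum, Finset.mul_sum]
          refine Finset.sum_congr rfl fun a _ => ?_
          rw [Finset.mul_sum]
          refine Finset.sum_congr rfl fun b _ => ?_
          rw [pow_add]
          ring
  have hmain : ∑ a : ZMod p, ∑ b : ZMod p, ι a ^ (p - 2) *
      (ι a * ι b ^ (p - 1) + ∑ jl ∈ I, c jl * ι a ^ jl.1 * ι b ^ jl.2) =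
      (∑ a : ZMod p, ι a ^ (p - 1)) * (∑ b : ZMod p, ι b ^ (p - 1)) +
        ∑ jl ∈ I, c jl * ((∑ a : ZMod p, ι a ^ (p - 2 + jl.1)) * (∑ b : ZMod p, ι b ^ jl.2)) := by
    rw [← hA, ← hB, ← Finset.sum_add_distrib]
    refine Finset.sum_congr rfl fun a _ => ?_
    rw [← Finset.sum_add_distrib]
    refine Finset.sum_congr rfl fun b _ => ?_
    rw [mul_add]
  -- each term of the second sum vanishes
  have hterm : ∀ jl ∈ I, c jl * ((∑ a : ZMod p, ι a ^ (p - 2 + jl.1)) * (∑ b : ZMod p, ι b ^ jl.2)) = 0 := by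
    intro jl hjl
    have hjl2 : 2 * jl.1 + 2 * jl.2 ≤ 2 * p := (Finset.mem_filter.mp hjl).2
    by_cases h1 : p ≤ jl.1 + jl.2
    · rw [hc jl hjl2 h1, zero_mul]
    · by_cases h2 : jl.2 < p - 1
      · rw [hS0 jl.2 h2, mul_zero, mul_zero]
      · have hl : jl.2 = p - 1 := by omega
        have hj : jl.1 = 0 := by omega
        rw [hj, add_zero, hS0 (p - 2) (by omega), zero_mul, mul_zero]
  rw [hmain, Finset.sum_eq_zero hterm, add_zero, hS1] at hsum
  norm_num at hsum

end PowerSums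

end CampaignW22

end Summit.ResolutionOfSingularities.ResolutionOfSingularities.Theorems

end
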